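import Summits.KontsevichZagierPeriods.Zeta5Search.WedgeDictionaryQPart
import Summits.KontsevichZagierPeriods.Zeta5Search.WedgeDictionaryForms
import Summits.KontsevichZagierPeriods.Zeta5Search.DualSeriesLemma19Record
import HarnessLib

/-!
# ζ(5) search — certificates: the record ray's approximating forms BY NAME (cell `pub-zeta5`, certifier 2)

HONEST FRAMING: systematic search; no irrationality claim unless certified.

OUR work (Summit side). Brown–Zudilin's record parameters `a·n`, `a = (8,16,10,15,12,16,18,13)`
(arXiv:2210.03391, Sect. 11, Theorem 1), dual parameters `b = b(a·n) = n·(41; 17,16,15,14,13,12,11)`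
(`DualSeriesLemma19.bRecord`), partner `b′ = b + e₇`. This file fixes, once and for all and WITHOUT any conjecture,
the objects every later certificate of the record ray refers to:

* `recordQ n = Q(a·n) ∈ ℤ` — the printed leading coefficient (17) (`BrownZudilin2022.QOf`);
* `recordP n = ρ(a·n)·(W(b′)V(b) − W(b)V(b′)) ∈ ℚ` — the wedge-dictionary companion (`rhoOf`, `coeffW`, `coeffV`);
* `recordForm n = ρ(a·n)·(W(b′)·F̃₇(b) − W(b)·F̃₇(b′)) ∈ ℝ` — the `ζ(3)`-free combination of two contiguous
  very-well-poised series (34) (`vwpDual 7`);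

and PROVES, for every `n ≥ 1`,

* `recordQ_eq_wedge` : `Q(a·n) = ρ(a·n)·(U(b)W(b′) − U(b′)W(b))` — the Q-part of the wedge dictionary
  (`WedgeDictionary.wedgeDictionary_Q`, a tree THEOREM) specialised to the ray (its side conditions decided here);
* `recordForm_eq` : `recordForm n = recordQ n · ζ(5) − recordP n` — by `WedgeDictionary.zeta3_elimination`.

So the record ray's linear forms in `1, ζ(5)` with the PRINTED integer coefficient `Q(a·n)` are an explicit, unconditional
object of the tree; the cellular integral `I(a·n)` and the open half of the dictionary (`wedgeDictionaryIntegralPart`)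
never enter. What is NOT here: any rate (growth of `Q`, decay of the form), any denominator, anything about `ζ(5)`.
-/

noncomputable section

open Finset

namespace Summit.KontsevichZagierPeriods.Zeta5Search.RecordRay

open Summit.KontsevichZagierPeriods.Zeta5Search.DualSeries
open Summit.KontsevichZagierPeriods.Zeta5Search.WedgeDictionary
open Summit.KontsevichZagierPeriods.Zeta5Search.DualSeriesLemma19 (bRecord bOfA_record)
open Literature.NumberTheory.Irrationality.BrownZudilin2022 (bOfA Converges QOf recordVec vwpDual
  convergenceForms)
open Literature.NumberTheory.Transcendental (zetaValue)

/-! ### The objects -/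

/-- The scaled record parameters `a·n = n·(8,16,10,15,12,16,18,13)`. -/
def aRec (n : ℕ) : Fin 8 → ℤ := fun i => (n : ℤ) * recordVec i

/-- The partner `b′ = b + e₇ = n·(41; 17,16,15,14,13,12,11) + e₇` of the record dual parameters. -/
def bRecord' (n : ℕ) : ℕ → ℤ := Function.update (bRecord n) 7 (bRecord n 7 + 1)

/-- `Q_n = Q(a·n)`, Brown–Zudilin's leading coefficient (17) on the record ray (an integer). -/
def recordQ (n : ℕ) : ℤ := QOf (aRec n)

/-- `P_n = ρ(a·n)·(W(b′)V(b) − W(b)V(b′))`, the rational companion of `Q_n` given by the wedge dictionary. -/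
def recordP (n : ℕ) : ℚ :=
  rhoOf (aRec n) * (coeffW (bRecord' n) * coeffV (bRecord n) - coeffW (bRecord n) * coeffV (bRecord' n))

/-- The approximating form `L_n = ρ(a·n)·(W(b′)·F̃₇(b) − W(b)·F̃₇(b′))` of the record ray. -/
def recordForm (n : ℕ) : ℝ :=
  (rhoOf (aRec n) : ℝ) *
    ((coeffW (bRecord' n) : ℝ) * vwpDual 7 (bRecord n) - (coeffW (bRecord n) : ℝ) * vwpDual 7 (bRecord' n))

/-! ### Side conditions on the ray (all `n`, resp. `n ≥ 1`) -/

/-- `b(a·n) = bRecord n`. -/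
theorem bOfA_aRec (n : ℕ) : bOfA (aRec n) = bRecord n := bOfA_record n

/-- The values of `bRecord n`: `b₀ = 41n`, `b_j = (18 − j)n` for `1 ≤ j ≤ 7`. -/
theorem bRecord_zero (n : ℕ) : bRecord n 0 = 41 * n := by simp [bRecord]

/-- The slots of `bRecord n`. -/
theorem bRecord_slot (n : ℕ) {j : ℕ} (hj1 : 1 ≤ j) (hj7 : j ≤ 7) : bRecord n j = (18 - j : ℕ) * n := by
  have h0 : j ≠ 0 := by omega
  simp [bRecord, h0, hj7]

/-- The record parameters converge for every `n` (all seventeen forms (3) are non-negative multiples of `n`). -/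
theorem converges_aRec (n : ℕ) : Converges (aRec n) := by
  intro x hx
  simp only [convergenceForms, aRec, recordVec, List.mem_cons, List.not_mem_nil, or_false,
    Matrix.cons_val_zero, Matrix.cons_val_one, Matrix.cons_val] at hx
  omega

/-- The region of the wedge dictionary: `0 ≤ b_i` and `2b_i ≤ b₀ + 1` for `i = 1,…,7`. -/
theorem region_aRec (n : ℕ) : ∀ i ∈ Icc 1 7, 0 ≤ bOfA (aRec n) i ∧ 2 * bOfA (aRec n) i ≤ bOfA (aRec n) 0 + 1 := by
  intro i hi
  rw [bOfA_aRec, bRecord_zero, bRecord_slot n (mem_Icc.1 hi).1 (mem_Icc.1 hi).2]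
  have h7 := (mem_Icc.1 hi).2
  have h1 := (mem_Icc.1 hi).1
  constructor
  · positivity
  · have : ((18 - i : ℕ) : ℤ) ≤ 17 := by omega
    nlinarith [this, (Nat.cast_nonneg n : (0 : ℤ) ≤ n)]

/-- `d(b(a·n)) = 25n ≥ 0`. -/
theorem dOf_aRec (n : ℕ) : dOf (bOfA (aRec n)) = 25 * n := by
  rw [dOf_bOfA]
  simp [aRec, recordVec]
  ring

/-- The box of `DualSeries` holds on the ray. -/
theorem inBox_bRecord (n : ℕ) : InBox (bRecord n) := by
  refine ⟨by rw [bRecord_zero]; positivity, fun j hj => ?_⟩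
  have h7 : j + 1 ≤ 7 := by have := mem_range.1 hj; omega
  rw [bRecord_zero, bRecord_slot n (by omega) h7]
  have : ((18 - (j + 1) : ℕ) : ℤ) ≤ 17 := by omega
  constructor
  · positivity
  · nlinarith [this, (Nat.cast_nonneg n : (0 : ℤ) ≤ n)]

/-- The partner `j = 7` is admissible for `n ≥ 1`: `2(b₇ + 1) ≤ b₀ + 1`. -/
theorem partner_aRec {n : ℕ} (hn : 1 ≤ n) : 2 * (bOfA (aRec n) 7 + 1) ≤ bOfA (aRec n) 0 + 1 := by
  rw [bOfA_aRec, bRecord_zero, bRecord_slot n (by norm_num) le_rfl]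
  push_cast
  have : (1 : ℤ) ≤ n := by exact_mod_cast hn
  nlinarith

/-! ### The two identities -/

/-- **Q-part of the wedge dictionary on the record ray**: for `n ≥ 1`,
`Q(a·n) = ρ(a·n)·(U(b)W(b′) − U(b′)W(b))` with `b = bRecord n`, `b′ = b + e₇`. -/
theorem recordQ_eq_wedge {n : ℕ} (hn : 1 ≤ n) :
    (recordQ n : ℚ) = rhoOf (aRec n) *
      (coeffU (bRecord n) * coeffW (bRecord' n) - coeffU (bRecord' n) * coeffW (bRecord n)) := by
  have h := wedgeDictionary_Q (aRec n) 7 (by simp) (converges_aRec n) (region_aRec n)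
    (by rw [dOf_aRec]; positivity) (partner_aRec hn)
  simpa only [recordQ, bRecord', bOfA_aRec] using h

/-- **The record ray's forms are `Q(a·n)ζ(5) − P_n`**: for `n ≥ 1`,
`ρ(a·n)·(W(b′)F̃₇(b) − W(b)F̃₇(b′)) = Q(a·n)·ζ(5) − P_n` (ζ(3)-elimination + the Q-part of the dictionary). -/
theorem recordForm_eq {n : ℕ} (hn : 1 ≤ n) :
    recordForm n = (recordQ n : ℝ) * zetaValue 5 - (recordP n : ℝ) := by
  have hd : 0 ≤ dOf (bRecord n) := by rw [← bOfA_aRec, dOf_aRec]; positivity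
  have hle : bRecord n 7 ≤ bRecord n 0 := by
    rw [bRecord_zero, bRecord_slot n (by norm_num) le_rfl]; push_cast; nlinarith
  have h3 := zeta3_elimination (bRecord n) (inBox_bRecord n) hd (j := 7) (by simp) hle
  have hQ : ((recordQ n : ℚ) : ℝ) = ((rhoOf (aRec n) *
      (coeffU (bRecord n) * coeffW (bRecord' n) - coeffU (bRecord' n) * coeffW (bRecord n)) : ℚ) : ℝ) := by
    rw [recordQ_eq_wedge hn]
  unfold recordForm recordP
  rw [show ((recordQ n : ℤ) : ℝ) = ((recordQ n : ℚ) : ℝ) by norm_cast, hQ]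
  simp only [bRecord'] at h3 ⊢
  rw [h3]
  push_cast
  ring

end Summit.KontsevichZagierPeriods.Zeta5Search.RecordRay
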